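import Mathlib.CategoryTheory.Galois.Equivalence
import Mathlib.Data.Countable.Small
import Mathlib.Data.Fintype.Shrink
import Mathlib.SetTheory.Cardinal.Finite
import HarnessLib

/-!
# Anabelioids: realising a finite continuous `π₁`-set as the fibre of an object

Grothendieck's characterisation of Galois categories ([SGA1] Exp. V §4, Thm. 4.1; Mochizuki,
*The geometry of anabelioids*, Publ. RIMS **40** (2004), §1.1 p. 9: a connected anabelioid "is
equivalent to `B(G)` for a profinite group `G`") says that the fibre functor `F` of a Galois category
`C` induces an equivalence of `C` with the category of finite sets with continuous `Aut F`-action;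
Mathlib proves this as the equivalence `PreGaloisCategory.functorToContAction F`
(`Mathlib.CategoryTheory.Galois.Equivalence`).  This proof-only file extracts the form the
covering constructions of [SemiAnbd] §2 (proofs of Prop. 2.5, 2.6, pp. 27–29: "universal
coverings", "the covering defined by the normal open subgroup `K ⊆ Π`", "copies of the covering
defined by the `Π_v`-set `Π_v/N_M`") consume:

* `exists_obj_fiber_equiv` — for ANY finite `Aut F`-set `X` (in any universe) all of whose
  stabilisers are open there is an object `A` of `C` and an `Aut F`-equivariant bijection
  `F(A) ≃ X`;
* `exists_obj_fiber_equiv_of_finite` — when `Aut F` is finite the openness condition is void.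

No definitions. Seat abc-iut-L6-t18 (abc-iut cell, [SemiAnbd] Prop. 2.6 vertex case).
[cite: SGA1, Exp. V Thm. 4.1]
-/

namespace Literature.AnabelianGeometry.Anabelioids

open CategoryTheory CategoryTheory.Limits CategoryTheory.PreGaloisCategory
open scoped FintypeCatDiscrete

universe w u₂ u₁ v

variable {C : Type u₁} [Category.{u₂} C] [GaloisCategory C]

/-- **Realising a finite continuous `π₁`-set** ([SGA1] V Thm. 4.1, essential surjectivity; [GeoAn]
§1.1): for a fibre functor `F` of a Galois category `C` and a finite `Aut F`-set `X` with open
stabilisers, there is an object `A` with an `Aut F`-equivariant bijection `F(A) ≃ X` (Mathlib's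
`functorToContAction F` is essentially surjective; the carrier is moved into the universe of `F` along
`equivShrink`). [cite: SGA1, Exp. V Thm. 4.1] -/
theorem exists_obj_fiber_equiv (F : C ⥤ FintypeCat.{w}) [FiberFunctor F] (X : Type v) [Finite X]
    [MulAction (Aut F) X] (hX : ∀ x : X, IsOpen (MulAction.stabilizer (Aut F) x : Set (Aut F))) :
    ∃ (A : C) (e : F.obj A ≃ X), ∀ (σ : Aut F) (a : F.obj A), e (σ • a) = σ • e a := by
  classical
  haveI : Small.{w} X := Countable.toSmall X
  let Z : Type w := Shrink.{w} X
  let e : X ≃ Z := (equivShrink X : X ≃ Shrink.{w} X)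
  letI : Fintype Z := Fintype.ofFinite Z
  letI : MulAction (Aut F) Z := e.symm.mulAction (Aut F)
  have hsmul : ∀ (g : Aut F) (z : Z), g • z = e (g • e.symm z) := fun _ _ => rfl
  let Y₀ : Action FintypeCat.{w} (Aut F) := Action.FintypeCat.ofMulAction (Aut F) (FintypeCat.of Z)
  have hstab : ∀ z : Z, IsOpen (MulAction.stabilizer (Aut F) z : Set (Aut F)) := by
    intro z
    have hz : MulAction.stabilizer (Aut F) z = MulAction.stabilizer (Aut F) (e.symm z) := by
      ext g
      simp only [MulAction.mem_stabilizer_iff, hsmul]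
      constructor
      · intro h
        simpa using congrArg e.symm h
      · intro h
        rw [h, Equiv.apply_symm_apply]
    rw [hz]
    exact hX _
  -- continuity of the action on the discrete finite set `Z`: orbit maps are locally constant
  have hfib : ∀ (z t : Z), IsOpen {σ : Aut F | σ • z = t} := by
    intro z t
    by_cases hne : ∃ σ₀ : Aut F, σ₀ • z = t
    · obtain ⟨σ₀, hσ₀⟩ := hne
      have hset : {σ : Aut F | σ • z = t} =
          (fun σ => σ₀⁻¹ * σ) ⁻¹' (MulAction.stabilizer (Aut F) z : Set (Aut F)) := by
        ext σ
        simp only [Set.mem_setOf_eq, Set.mem_preimage, SetLike.mem_coe,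
          MulAction.mem_stabilizer_iff, mul_smul]
        constructor
        · intro h
          rw [h, ← hσ₀, inv_smul_smul]
        · intro h
          have h' := congrArg (fun y => σ₀ • y) h
          simpa [smul_smul, hσ₀] using h'
      rw [hset]
      exact (hstab z).preimage (continuous_const.mul continuous_id)
    · have hset : {σ : Aut F | σ • z = t} = ∅ := by
        ext σ
        simp only [Set.mem_setOf_eq, Set.mem_empty_iff_false, iff_false]
        exact fun h => hne ⟨σ, h⟩
      rw [hset]
      exact isOpen_empty
  letI : TopologicalSpace Z := ⊥
  haveI : DiscreteTopology Z := ⟨rfl⟩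
  have hcont : Continuous fun p : Aut F × Z => p.1 • p.2 :=
    continuous_prod_of_discrete_right.mpr fun z => continuous_discrete_rng.mpr fun t => hfib z t
  have hY₀ : Action.IsContinuous Y₀ := by
    rw [Action.isContinuous_def]
    exact hcont
  let Y : ContAction FintypeCat.{w} (Aut F) := ⟨Y₀, hY₀⟩
  let A : C := (functorToContAction F).objPreimage Y
  let i : (functorToContAction F).obj A ≅ Y := (functorToContAction F).objObjPreimageIso Y
  -- the underlying bijection of fibres and its equivariance
  let f : F.obj A → Z := fun x => i.hom.hom.hom x
  let f' : Z → F.obj A := fun z => i.inv.hom.hom z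
  have hff' : ∀ x, f' (f x) = x := fun x => by
    change (i.hom.hom.hom ≫ i.inv.hom.hom) x = x
    rw [← Action.comp_hom, ← ObjectProperty.FullSubcategory.comp_hom, i.hom_inv_id]
    rfl
  have hf'f : ∀ z, f (f' z) = z := fun z => by
    change (i.inv.hom.hom ≫ i.hom.hom.hom) z = z
    rw [← Action.comp_hom, ← ObjectProperty.FullSubcategory.comp_hom, i.inv_hom_id]
    rfl
  let ef : F.obj A ≃ Z := ⟨f, f', hff', hf'f⟩
  have hequiv : ∀ (σ : Aut F) (x : F.obj A), ef (σ • x) = σ • ef x := by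
    intro σ x
    have h := ConcreteCategory.congr_hom (i.hom.hom.comm σ) x
    simp only [FintypeCat.comp_apply] at h
    exact h
  refine ⟨A, ef.trans e.symm, fun σ a => ?_⟩
  rw [Equiv.trans_apply, Equiv.trans_apply, hequiv, hsmul, Equiv.symm_apply_apply]

/-- When `π₁ = Aut F` is finite (then discrete), EVERY finite `Aut F`-set is the fibre of an object:
the form used for the local pieces "`Π_v/N_M`", "universal coverings" of [SemiAnbd] pp. 27–29.
[cite: SGA1, Exp. V Thm. 4.1] -/
theorem exists_obj_fiber_equiv_of_finite (F : C ⥤ FintypeCat.{w}) [FiberFunctor F]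
    [Finite (Aut F)] (X : Type v) [Finite X] [MulAction (Aut F) X] :
    ∃ (A : C) (e : F.obj A ≃ X), ∀ (σ : Aut F) (a : F.obj A), e (σ • a) = σ • e a :=
  exists_obj_fiber_equiv F X fun _ => isOpen_discrete _

end Literature.AnabelianGeometry.Anabelioids
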